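import Summits.ResolutionOfSingularities.ResolutionOfSingularities.Theorems.IndSmoothValuativeSmoothingRelLUComposite
import Literature.AlgebraicGeometry.Resolution.RankOneReductionProofs
import HarnessLib

/-!
# Relative local uniformization of a composite valuation from the coarsening and the residue
# valuation (Novacoski–Spivakovsky's composite step, one pair `O ≤ O₁`, general form)

Support file for crux stmt-ResolutionOfSingularities-16087 (`ValuativeSmoothing`, route file
`Theses/IndSmooth.lean`), line `birth`, wave 5: the general composite step. For fields `k ⊆ K`
and valuation rings `O ≤ O₁` of `K` containing `k` (so `ν_O = ν₁ ∘ ν₂`, `ν₁ = ν_{O₁}`, `ν₂` the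
valuation of the residue field `κ(O₁)` with ring `O / 𝔪_{O₁} = residueValuationSubring O O₁ _`),
SUPPOSE
* `ν₁` admits relative local uniformization over `k` (`h₁ : RelLocalUniformization k K O₁`);
* the residue field of `O₁` is generated over `k`, as a field of fractions, by the residues of a
  finite set `s ⊆ O`: every residue class of `O₁` is `ā / b̄` with `a, b ∈ k[s]`, `ν₁(b) = 0`
  (`hres`, stated in `K`: `ν₁(z - a / b) > 0`);
* `ν₂` admits relative local uniformization over `k` in every abstract copy `κ` of the residue
  field: for every field `κ ⊇ k` and every `k`-compatible ring isomorphism `ι : κ → κ(O₁)`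
  (bijective, `ι ∘ (k → κ) = residue ∘ (k → O₁)`), the restriction
  `(residueValuationSubring O O₁ _).comap ι` of `ν₂` admits relative local uniformization
  over `k` (`h₂`).
THEN `O` admits relative local uniformization over `k` (`relLU_of_le_of_relLU_residue`).

This is the generalisation of `relLU_of_le_of_purelyTranscendentalResidue`
(`IndSmoothValuativeSmoothingRelLUComposite.lean`): there the residue field is a rational
function field `k(x̄, ȳ)` and `h₂` is supplied by local uniformization of all valuations of
`k(x', y')`; here `h₂` is abstract.

**Proof.** The assembly of Novacoski–Spivakovsky's proof of their Thm. 1.1 (§3.1) for the single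
decomposition `ν = ν₁ ∘ ν₂`, exactly as in the tree's `NovacoskiSpivakovsky2014_holds` but with
the two inductive inputs replaced by `h₁` and `h₂`. Given an affine model `R ⊆ O`, enlarge it to
`R' = R[s] ⊆ O`; Cor. 2.14 (`novacoskiSpivakovsky2014_cor214`, input `h₁`) gives `A₁ ⊇ R'` in
`O` regular at the centre of `ν₁`. For Cor. 2.17 (`novacoskiSpivakovsky2014_cor217`) one needs
a `ν₂`-uniformizing model above the residue ring `φ(A₁) ⊆ κ`, `ι : κ → κ(O₁)` a subfield
containing the residues of `A₁`: since `k[s] ⊆ A₁`, `ι` is onto (`residueChart_surjective`, from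
`hres`: every residue is `ι (φ a / φ b)`), hence bijective, and `ι` is compatible with `k`
because `φ` is a `k`-algebra map; so `h₂` uniformizes the restriction `(O / 𝔪_{O₁}).comap ι`
of `ν₂` on the model `φ(A₁)`. The final step of §3.1 (`novacoskiSpivakovsky2014_step`) then
produces the regular model above `R' ⊇ R`.

## Source

J. Novacoski, M. Spivakovsky, *Reduction of local uniformization to the rank one case*,
Valuation Theory in Interaction (Segovia–El Escorial 2011), EMS Ser. Congr. Rep. (2014)
404–431; arXiv:1204.4751v1: Cor. 2.14, Cor. 2.17, §3.1. [NovacoskiSpivakovsky2014]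
-/

-- single-problem summit: the doubled namespace component is forced
set_option linter.dupNamespace false

namespace Summit.ResolutionOfSingularities.ResolutionOfSingularities.Theorems.ValuativeSmoothing

open IsLocalRing Literature.AlgebraicGeometry.Resolution

section residueChartAdjoin

variable {k K : Type} [Field k] [Field K] [Algebra k K]

/-- **Every residue is a fraction of residues of `k[s]`** (general generating set). For a model
`A ⊆ O₁` containing `k[S]` with residue map `φ : A → κ ⊆ κ(O₁)` (`ι ∘ φ = residue`): if every
residue class of `O₁` is `ā / b̄` with `a, b ∈ k[S]`, `ν₁(b) = 0` (hypothesis `hres`, stated in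
`K`: `ν₁(z - a / b) > 0`), then every residue `z̄`, `z ∈ O₁`, equals `ι (φ a / φ b)` for such
`a, b`, with `φ b ≠ 0`. [folklore] -/
theorem residue_eq_residueChart_adjoin (O₁ : ValuationSubring K) (A : Subalgebra k K)
    (hAO₁ : A.toSubring ≤ O₁.toSubring) {κ : Type*} [Field κ] [Algebra k κ]
    (ι : κ →+* ResidueField O₁) (φ : A →ₐ[k] κ)
    (hφ : ∀ a : A, ι (φ a) = residue O₁ ⟨(a : K), hAO₁ a.2⟩)
    (S : Set K) (hadj : Algebra.adjoin k S ≤ A)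
    (hres : ∀ z ∈ O₁, ∃ a ∈ Algebra.adjoin k S, ∃ b ∈ Algebra.adjoin k S,
      O₁.valuation b = 1 ∧ O₁.valuation (z - a / b) < 1) (z : O₁) :
    ∃ a b : A, (a : K) ∈ Algebra.adjoin k S ∧ (b : K) ∈ Algebra.adjoin k S ∧ φ b ≠ 0 ∧
      residue O₁ z = ι (φ a / φ b) := by
  obtain ⟨a, ha, b, hb, hb1, hz⟩ := hres z z.2
  have haA : a ∈ A := hadj ha
  have hbA : b ∈ A := hadj hb
  have haO₁ : a ∈ O₁ := hAO₁ haA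
  have hbO₁ : b ∈ O₁ := hAO₁ hbA
  have hbi : b⁻¹ ∈ O₁ := inv_mem_of_valuation_eq_one O₁ hb1
  have hab : a / b ∈ O₁ := by
    rw [div_eq_mul_inv]
    exact mul_mem haO₁ hbi
  have hresb : residue O₁ ⟨b, hbO₁⟩ ≠ 0 := by
    rw [ne_eq, residue_eq_zero_iff, ValuationSubring.valuation_lt_one_iff]
    change ¬ O₁.valuation b < 1
    rw [hb1]
    exact lt_irrefl 1
  refine ⟨⟨a, haA⟩, ⟨b, hbA⟩, ha, hb, ?_, ?_⟩
  · intro h0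
    apply hresb
    rw [← hφ ⟨b, hbA⟩, h0, map_zero]
  · rw [map_div₀, hφ, hφ]
    change residue O₁ z = residue O₁ ⟨a, haO₁⟩ / residue O₁ ⟨b, hbO₁⟩
    rw [← residue_div O₁ a b haO₁ hbO₁ hb1 hab, ← sub_eq_zero, ← map_sub, residue_eq_zero_iff,
      ValuationSubring.valuation_lt_one_iff]
    exact hz

/-- **The residue chart is onto.** In the situation of `residue_eq_residueChart_adjoin`
(`k[S] ⊆ A ⊆ O₁`, `ι ∘ φ = residue`, every residue class a fraction of residues of `k[S]`),
the comparison map `ι : κ → κ(O₁)` is surjective. [folklore] -/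
theorem residueChart_surjective (O₁ : ValuationSubring K) (A : Subalgebra k K)
    (hAO₁ : A.toSubring ≤ O₁.toSubring) {κ : Type*} [Field κ] [Algebra k κ]
    (ι : κ →+* ResidueField O₁) (φ : A →ₐ[k] κ)
    (hφ : ∀ a : A, ι (φ a) = residue O₁ ⟨(a : K), hAO₁ a.2⟩)
    (S : Set K) (hadj : Algebra.adjoin k S ≤ A)
    (hres : ∀ z ∈ O₁, ∃ a ∈ Algebra.adjoin k S, ∃ b ∈ Algebra.adjoin k S,
      O₁.valuation b = 1 ∧ O₁.valuation (z - a / b) < 1) :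
    Function.Surjective ι := by
  intro w
  obtain ⟨z, hz⟩ := residue_surjective w
  obtain ⟨a, b, -, -, -, h⟩ := residue_eq_residueChart_adjoin O₁ A hAO₁ ι φ hφ S hadj hres z
  exact ⟨φ a / φ b, by rw [← h, hz]⟩

/-- **The residue chart is compatible with the base field.** For a model `A ⊆ O₁` over `k` with
residue map `φ : A → κ ⊆ κ(O₁)` a `k`-ALGEBRA map (`ι ∘ φ = residue`), the comparison map `ι`
sends `c ∈ k ⊆ κ` to the residue of `c ∈ k ⊆ O₁`. [folklore] -/
theorem residueChart_algebraMap (O₁ : ValuationSubring K) (hk : ∀ c : k, algebraMap k K c ∈ O₁)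
    (A : Subalgebra k K) (hAO₁ : A.toSubring ≤ O₁.toSubring) {κ : Type*} [Field κ] [Algebra k κ]
    (ι : κ →+* ResidueField O₁) (φ : A →ₐ[k] κ)
    (hφ : ∀ a : A, ι (φ a) = residue O₁ ⟨(a : K), hAO₁ a.2⟩) (c : k) :
    ι (algebraMap k κ c) = residue O₁ ⟨algebraMap k K c, hk c⟩ := by
  rw [← φ.commutes c, hφ]
  rfl

end residueChartAdjoin

/-- **Relative local uniformization of a composite valuation from its two components**
(Novacoski–Spivakovsky 2014, proof of Thm. 1.1, §3.1, for ONE decomposition `ν = ν₁ ∘ ν₂`;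
general form of `relLU_of_le_of_purelyTranscendentalResidue`). Let `k ⊆ K` be fields and
`O ≤ O₁` valuation rings of `K` with `k ⊆ O₁` (`hk`). Assume: `ν₁ = ν_{O₁}` admits relative
local uniformization over `k` (`h₁`); the residue field of `O₁` is generated by the residues of
a finite set `s ⊆ O` (`hres`: every `z ∈ O₁` is `≡ a / b (mod 𝔪_{O₁})` with `a, b ∈ k[s]`,
`ν₁(b) = 0`); and for every field `κ ⊇ k` with a `k`-compatible ring isomorphism
`ι : κ → κ(O₁)` the restriction of `ν₂` along `ι` admits relative local uniformization over
`k` (`h₂`). Then `O` admits relative local uniformization over `k`. Proof: enlarge the model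
`R` to `R[s]`, then Cor. 2.14 (`novacoskiSpivakovsky2014_cor214`, input `h₁`), Cor. 2.17
(`novacoskiSpivakovsky2014_cor217`, input `h₂` on the residue chart `κ ⊇ φ(A₁)`, which is all
of `κ(O₁)`: `residueChart_surjective`, and `k`-compatible: `residueChart_algebraMap`) and the
final step of §3.1 (`novacoskiSpivakovsky2014_step`).
[cite: NovacoskiSpivakovsky2014, Thm. 1.1 (proof, §3.1)] -/
theorem relLU_of_le_of_relLU_residue (k K : Type) [Field k] [Field K] [Algebra k K]
    (O O₁ : ValuationSubring K) (hO : O ≤ O₁) (hk : ∀ c : k, algebraMap k K c ∈ O₁)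
    (h₁ : RelLocalUniformization k K O₁) (s : Finset K) (hs : (↑s : Set K) ⊆ O)
    (hres : ∀ z ∈ O₁, ∃ a ∈ Algebra.adjoin k (↑s : Set K), ∃ b ∈ Algebra.adjoin k (↑s : Set K),
      O₁.valuation b = 1 ∧ O₁.valuation (z - a / b) < 1)
    (h₂ : ∀ (κ : Type) [Field κ] [Algebra k κ] (ι : κ →+* ResidueField O₁),
      Function.Bijective ι →
      (∀ c : k, ι (algebraMap k κ c) = residue O₁ ⟨algebraMap k K c, hk c⟩) →
      RelLocalUniformization k κ ((residueValuationSubring O O₁ hO).comap ι)) :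
    RelLocalUniformization k K O := by
  classical
  intro R hR hfrac hRO
  haveI := hfrac
  -- Step 0: enlarge the model to `R' = R[s] ⊆ O`
  have hkO : ∀ c : k, algebraMap k K c ∈ O := fun c => hRO (R.algebraMap_mem c)
  let Ok : Subalgebra k K := ({ O.toSubring with algebraMap_mem' := hkO } : Subalgebra k K)
  let R' : Subalgebra k K := R ⊔ Algebra.adjoin k (↑s : Set K)
  have hadjfg : (Algebra.adjoin k (↑s : Set K)).FG := Subalgebra.fg_adjoin_finset s
  have hR'fg : R'.FG := hR.sup hadjfg
  have hRR' : R ≤ R' := le_sup_left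
  have hadjR' : Algebra.adjoin k (↑s : Set K) ≤ R' := le_sup_right
  have hR'Ok : R' ≤ Ok := by
    refine sup_le (fun z hz => hRO hz) ?_
    rw [Algebra.adjoin_le_iff]
    exact hs
  have hR'O : R'.toSubring ≤ O.toSubring := fun z hz => hR'Ok hz
  haveI hfrac' : IsFractionRing R' K := isFractionRing_subalgebra_of_le R R' hRR'
  -- Step 1: Cor. 2.14 with the local uniformization `h₁` of `ν₁`
  obtain ⟨A₁, hA₁, hR'A₁, hA₁fg, hreg₁⟩ :=
    novacoskiSpivakovsky2014_cor214 O O₁ hO R' hR'fg hfrac' hR'O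
      (h₁ R' hR'fg hfrac' (hR'O.trans hO))
  haveI hfrac₁ : IsFractionRing A₁ K := isFractionRing_subalgebra_of_le R' A₁ hR'A₁
  have hadjA₁ : Algebra.adjoin k (↑s : Set K) ≤ A₁ := hadjR'.trans hR'A₁
  -- Step 2: the input of Cor. 2.17 from `h₂` on the residue chart `κ ⊇ φ(A₁)` (`= κ(O₁)`)
  have ih₂' : ∀ (κ : Type) [Field κ] [Algebra k κ] (ι : κ →+* ResidueField O₁) (φ : A₁ →ₐ[k] κ),
      (∀ a : A₁, ι (φ a) = residue O₁ ⟨(a : K), (hA₁.trans hO) a.2⟩) →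
      IsFractionRing φ.range κ →
      ∃ (B : Subalgebra k κ)
        (hB : B.toSubring ≤ ((residueValuationSubring O O₁ hO).comap ι).toSubring),
        φ.range ≤ B ∧ B.FG ∧
        IsRegularLocalRing (Localization.AtPrime
          ((maximalIdeal ((residueValuationSubring O O₁ hO).comap ι)).comap
            (Subring.inclusion hB))) := by
    intro κ _ _ ι φ hφ hfr
    have hbij : Function.Bijective ι :=
      ⟨ι.injective, residueChart_surjective O₁ A₁ (hA₁.trans hO) ι φ hφ (↑s : Set K) hadjA₁ hres⟩
    have hιk : ∀ c : k, ι (algebraMap k κ c) = residue O₁ ⟨algebraMap k K c, hk c⟩ :=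
      residueChart_algebraMap O₁ hk A₁ (hA₁.trans hO) ι φ hφ
    have hLU : RelLocalUniformization k κ ((residueValuationSubring O O₁ hO).comap ι) :=
      h₂ κ ι hbij hιk
    have hfg : φ.range.FG := by
      have h := ((Subalgebra.fg_top A₁).mpr hA₁fg).map φ
      rwa [Algebra.map_top] at h
    have hle : φ.range.toSubring ≤ ((residueValuationSubring O O₁ hO).comap ι).toSubring := by
      intro z hz
      obtain ⟨a, rfl⟩ := (AlgHom.mem_range φ).mp (show z ∈ φ.range from hz)
      change φ a ∈ (residueValuationSubring O O₁ hO).comap ι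
      rw [ValuationSubring.mem_comap, hφ]
      exact (residue_mem_residueValuationSubring_iff O O₁ hO _).mpr (hA₁ a.2)
    exact hLU φ.range hfg hfr hle
  obtain ⟨A₂, hA₂, hA₁₂, hA₂fg, hreg₂, hreg₂'⟩ :=
    novacoskiSpivakovsky2014_cor217 O O₁ hO A₁ hA₁ hA₁fg hfrac₁ hreg₁ ih₂'
  haveI hfrac₂ : IsFractionRing A₂ K := isFractionRing_subalgebra_of_le A₁ A₂ hA₁₂
  -- Step 3: the final step of §3.1
  obtain ⟨A₃, hA₃, hA₂₃, hA₃fg, hreg₃⟩ :=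
    novacoskiSpivakovsky2014_step O O₁ hO A₂ hA₂ hA₂fg hfrac₂ hreg₂ hreg₂'
  exact ⟨A₃, hA₃, (hRR'.trans hR'A₁).trans (hA₁₂.trans hA₂₃), hA₃fg, hreg₃⟩

end Summit.ResolutionOfSingularities.ResolutionOfSingularities.Theorems.ValuativeSmoothing
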